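/-
Copyright (c) 2026 the pub-hodgecm-mathlib formalisation cell (harness21).  Prover seat hodgecm-mathlib-LH4-p04 (g5), Track A «(D-RAM) FOUR-FRAME», unit U2H, the census leaf
(ρ2b′-X) `stub_U2H_fixedPointCensus_typeTwo_unit0` — typed bottom SOCKET (C) of the payer's MAP v3 (LH4-p14): the order-count census on type RamM (lead LH4-p04, co-hand
LH4-p06; dealer WORD #30), composed over the ★ organs of the LH4 ∕ F0P3 ∕ F0P3a squads (LH4-p05, p06, p07, p09, p11, p12, p14, F0P3-p01, F0P3a-p01 and this seat).  2026-09-04.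
-/
import Summits.HodgeConjecture.HodgeConjecture.Theorems.F0P3cDyRamBlockCensusOrderForm
import Summits.HodgeConjecture.HodgeConjecture.Theorems.F0P3cDyRamFrameRamMAtUniformiser            -- (this seat, p858468): (C-0″) `exists_uniformiser_frame_ramM` (brings ★ p858086 p858161 p857943 p858318)
import Summits.HodgeConjecture.HodgeConjecture.Theorems.F0P3cDyRamFrameRamMLetters                  -- ★ p858066 (this seat): twist
import Summits.HodgeConjecture.HodgeConjecture.Theorems.F0P3cDyRamTokenDepthNearOne                  -- ★ p858075 (LH4-p07): `exists_nhds_one_le_tokenDepth`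
import Summits.HodgeConjecture.HodgeConjecture.Theorems.F0P3cDyRamTypeTwoBlockCongruenceNhds           -- ★ p858116 (LH4-p11): `exists_nhds_one_block_congr`
import Summits.HodgeConjecture.HodgeConjecture.Theorems.F0P3cDyRamTypeTwoTubeLetters                   -- ★ p858060 (LH4-p11): `v_disc_lt_tube`
import Summits.HodgeConjecture.HodgeConjecture.Theorems.F0P3cDyRamUniformizerPowerTube               -- ★ p858117 (LH4-p11): `v_pow_lt_v_two`, `v_pow_sq_lt_tube`
import Summits.HodgeConjecture.HodgeConjecture.Theorems.F0P3cDyRamCensusBottomArith                      -- ★ p858013 (LH4-p07): `census_bottom_arith_eisenstein`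
import Summits.HodgeConjecture.HodgeConjecture.Theorems.F0P3cDyRamTypeTwoAnisotropyOfFrame                 -- ★ p858030 (LH4-p11): `haniso`
import Summits.HodgeConjecture.HodgeConjecture.Theorems.F0P3cDyRamTypeUBottomFacts                        -- ★ (LH4-p11): `mul_map_eq_one_of_mem_unitary_one`, `map_fixed_and_mul_map_eq_one`
import Summits.HodgeConjecture.HodgeConjecture.Theorems.F0P3cDyRamTokenBridgeCM                           -- ★ p858173 (LH4-p14): `valued_quadratic_of_mtoken`
import Summits.HodgeConjecture.HodgeConjecture.Theorems.F0P3cDyRamTokenLettersRamM                        -- (this seat, p858217 pending): `v_sub_eq_exp_of_token_ramM`, spellings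
import Summits.HodgeConjecture.HodgeConjecture.Theorems.F0P3cDyRamTokenRealizabilityRamM                  -- (this seat, p858219 pending): `hparW_of_frame_ramM`
import Summits.HodgeConjecture.HodgeConjecture.Theorems.F0P3cDyRamHSideClosedFormRamM                     -- ★ p858207 (LH4-p09): (C-6) `hSide_closedForm_ramM_hLevel`
import Summits.HodgeConjecture.HodgeConjecture.Theorems.F0P3cDyRamToricCensusSumRamMWeldOfFrame            -- (this seat, p858394): (C-3′) `toricCensusSum_ramM_weld_of_frame` (brings ★ weld, tables, near∕far, class letters, K′ pkg)
import Summits.HodgeConjecture.HodgeConjecture.Theorems.F0P3cDyRamOrderCountCellsBound                     -- ★ p858283 (F0P3-p01 (g34)): (S-R)(S-R′) `hRcells_h`, `hRcells_h'` (type-free)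
import Summits.HodgeConjecture.HodgeConjecture.Theorems.F0P3cDyRamResidueFieldEvenCard                     -- ★ p858326 (LH4-p06): `two_dvd_natCard_residueField_of_v_two_lt_one`
import Summits.HodgeConjecture.HodgeConjecture.Theorems.F0P3cDyRamSignSymbolRamM                        -- ★ p858419 (F0P3a-p01 (g34)): (C-5b) Σ3b `hilbertSymbol_eq_one_iff_exists_rhoNorm_signKappa_ramM`
import Summits.HodgeConjecture.HodgeConjecture.Theorems.F0P3cDyRamSignLawRamM                           -- ★ (F0P3a-p01 (g34)): (C-5b) Σ3c `sign_law_ramM`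
import Literature.NumberTheory.Rogawski1990.FinExplicitTransferFactorInertExponent                     -- ★ `eval_finCharpolyTwo_finGammaTwo_apply_eq_quadratic`
import HarnessLib

/-!
# Socket (C): the order-count census of the (ρ2b′-X) leaf on type RamM (Rogawski 1990 §4.9; Kottwitz 1986 §1)

At a place `v` of `L⁺` RAMIFIED in the CM field `L` (`e(w∕v) ≠ 1`; `σ_w` the local conjugation, `ϖ` a uniformiser of `L_w` carrying the ramified datum
`IsRamifiedQuadraticDatum σ_w ϖ d tE`, residue characteristic `2`), the census of (ρ2b′-X) is read through an auxiliary quadratic `E'∕L` and a `c₁`-stable place `w₁ ∣ w`;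
socket (C) is the bottom on which the elliptic generator is WILD: `|α − ρα|_{w₁} < 1` (type RamM, `M = E'_{w₁}` totally ramified over `L⁺_v`, `|ι_{w₁} a| = |a|²`).
`orderCountCensusC` produces `V ∈ 𝓝 1` in `H_v = U(2)_v × U(1)_v` such that for every `G`-regular `γH ∈ V` with no `L_w`-rational eigenvalue, every RamM frame
`(E', c₁, δ, m₀, s, w₁, Θ, α, λ)` over it and every pair of line models `(φ, h)`, `(φ′, h′)` with their cut-off∕level∕glue data (the binders of SOCKET-hOCC.v1 869d0c15,
verbatim): (i) every doubly fixed unit is a `Θ`-norm; (ii) for every m-token `m` and every `β` reading the side symbol, the two order counts `A, A′` satisfy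
`(q − 1)(A − A′) = (β, θ)_v · q^m · ((q − 1)(#Fix(γH.1) + d % 2) − 2(q^{d − d%2} − 1))`, `q = #𝓀(L_w)`.

## Proof — one composition over ★ organs
`V` := tokens `≥ 3d + 3tE + 2` (★ p858075) ∩ plane block `≡ 1 (ϖ^{2tE+2})` (★ p858116).  (C-0″) ★ p858468 `exists_uniformiser_frame_ramM`: THE uniformiser `ϖM` with
`α − ρα = ϖM − ρϖM` (so the census at `(α, h)` IS the census at `(ϖM, h)`, ★ p858066 twist unit `1`), the three data, the norm clause (i), `n₀`, `hF4`, the Σ2 unit, the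
dictionary `dΘ = 2g`, `dτ = 2s0`, `g + s0 = d` (★ p858086 p857943 p858161 p858318); the `U(1)` token `u = ι u₀` (★ `TypeUBottomFacts`); the level `jl` of `λ`; (C-5a) the
m-token `|λ − u| = exp(−2m)` (★ p858173 + ★ p858217); (C-5c) S6b-RM ★ p858219 (`hparW`, `m ≤ jl`, `hreg`); (C-4) the cut-offs ★ p858283 (F0P3-p01) and the re-indexing
★ p858280; (C-6) the H-side ★ p858207 (LH4-p09); anisotropy of `h′` ★ p858030; half-orders ★ p858341; `2 ∣ q` ★ p858326; (C-5b) the sign `ε := (β, θ)_v`: Σ3b ★ p858419,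
Σ3c ★ p858460 `sign_law_ramM` (F0P3a-p01; head glue LH4-p13) give the four side letters, the window letter from `hST` at `ω = 1`; (C-3′) ONE call of ★ p858394
`toricCensusSum_ramM_weld_of_frame` (K′ package, class letters, tables, GEN∕OFF, near∕far top cells, weld); closing arithmetic ★ p858013 (LH4-p07), `S := d − d % 2`.
HONEST LABEL: a helper toward h413 = stmt-HodgeConjecture-24833 (`--supports`, count-neutral); HC_CM is proved only modulo the 7 printed citations (2 remaining
named inputs: hLiu418 = stmt-HodgeConjecture-24832, h413 = stmt-HodgeConjecture-24833) until rung 0 closes; (ρ2b′-X) :418 stays OPEN until the payer's head lands.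

## References
* [Rogawski1990] J. D. Rogawski, *Automorphic Representations of Unitary Groups in Three Variables*, Ann. of Math. Stud. 123 (1990), §4.9 pp. 55–58 (Prop. 4.9.1, Lemma 4.9.3), §12.2.
* [Kottwitz1986BaseChangeUnits] R. E. Kottwitz, *Base change for unit elements of Hecke algebras*, Compositio Math. 60 (1986), §1 pp. 240–241.
* [LabesseLanglands1979] J.-P. Labesse, R. P. Langlands, *L-indistinguishability for SL(2)*, Canad. J. Math. 31 (1979), §2 pp. 7–8.
* [Serre1979] J.-P. Serre, *Local Fields*, GTM 67 (1979): Ch. IV §1–§2, Ch. V §3.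
-/

set_option autoImplicit false

noncomputable section

namespace Summit.HodgeConjecture.HodgeConjecture.Cruxes.H413.F0P3cDyRamOrderCountCensusRamM

open MeasureTheory Measure NumberField IsDedekindDomain Topology Filter
open Literature.NumberTheory.Automorphic Literature.NumberTheory.Automorphic.UnitaryGroup Literature.NumberTheory.Automorphic.IntegralReduction
open Literature.NumberTheory.Rogawski1990 Literature.NumberTheory.GaloisRepresentations
open Literature.NumberTheory.Automorphic.UnitaryThreeFourFrame
open scoped Matrix MatrixGroups Classical Valued
open Literature.NumberTheory.Automorphic.UnitaryLatticeTree Literature.NumberTheory.Automorphic.HermitianLattice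
open Literature.NumberTheory.QuadraticForms
-- the sibling organ namespaces under `…Cruxes.H413` (relative `open`)
open F0P3cDyRamToricCensusDefs F0P3cDyRamFrameRamMAtUniformiser F0P3cDyRamFrameRamMLetters F0P3cDyRamTokenDepthNearOne F0P3cDyRamTypeTwoBlockCongruenceNhds
  F0P3cDyRamTypeTwoTubeLetters F0P3cDyRamUniformizerPowerTube F0P3cDyRamToricLevelCensusRamM F0P3cDyRamToricLevelCensusRamMAtThirdField F0P3cDyRamOrderFiltrationRange
  F0P3cDyRamCensusBottomArith F0P3cDyRamTypeTwoAnisotropyOfFrame F0P3cDyRamTypeUBottomFacts F0P3cDyRamTokenBridgeCM F0P3cDyRamTokenLettersRamM F0P3cDyRamTokenRealizabilityRamM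
  F0P3cDyRamOrderCountCellsBound F0P3cDyRamHSideClosedFormRamM

set_option maxHeartbeats 2000000 in -- statement-heavy socket head (70 binders; as ★ p858353 socket (B))
/-- **SOCKET (C) — THE ORDER-COUNT CENSUS OF (ρ2b′-X), TYPE RamM** (`SOCKET-hOCC.v1` 869d0c15 verbatim behind the binders `(L) (w) (hw) (he) (ϖ) (hϖ) (d tE) (hD)
(h2v)`; `tE`-generic — HEAD.C v3 = v2 − `htE`, dealer WORD #33 (α)): a neighbourhood `V ∈ 𝓝 1` of `U(2)_v × U(1)_v` on which, for every `G`-regular `γH` with irreducible `w`-block and every RamM frame with its two line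
models, (i) every `ρ′`- and `Θ`-fixed unit of `E'_{w₁}` is a `Θ`-norm, and (ii) `(q − 1)(A − A′) = (β, θ)_v · q^m · ((q − 1)(#Fix + d%2) − 2(q^{d−d%2} − 1))` for the two
cut-off order counts `A, A′`.  One composition over ★ organs (module docstring).
[cite: Rogawski1990, §4.9 pp. 55–58, Prop. 4.9.1, Lemma 4.9.3; §12.2] [cite: Kottwitz1986BaseChangeUnits, §1 pp. 240–241] [cite: LabesseLanglands1979, §2 pp. 7–8] [cite: Serre1979, Ch. IV §1–§2; Ch. V §3] -/
theorem orderCountCensusC (L : Type) [Field L] [NumberField L] [IsCMField L]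
    {v : HeightOneSpectrum (𝓞 ↥(maximalRealSubfield L))} (w : UnitaryGroup.PlacesOver L v)
    (hw : IsCMField.complexConj L • w.1 = w.1) (he : v.asIdeal.ramificationIdx' w.1.asIdeal ≠ 1)
    (ϖ : (w.1.adicCompletion L)) (hϖ : Valued.v ϖ = WithZero.exp (-1 : ℤ)) (d tE : ℕ)
    (hD : IsRamifiedQuadraticDatum (galAdicCompletionMap (L := L) (IsCMField.complexConj L) hw) ϖ d tE)
    (h2v : Valued.v (2 : (w.1.adicCompletion L)) < 1)
    [Fintype (Valued.ResidueField (w.1.adicCompletion L))] :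
      ∃ V ∈ 𝓝 (1 : ((UnitaryGroup.cmDatum L 2 (Matrix.of fun i j : Fin 2 => if i.val + j.val + 1 = 2 then (1 : L) else 0)).Local v × (UnitaryGroup.cmDatum L 1 (Matrix.of fun i j : Fin 1 => if i.val + j.val + 1 = 1 then (1 : L) else 0)).Local v)), ∀ γH ∈ V, IsLocalGRegular L v γH →
        ¬ (∃ x : (w.1.adicCompletion L), (((((γH).1.val : GL (Fin 2) (UnitaryGroup.LocalRing L v)).val.map (Pi.evalRingHom (fun w' : UnitaryGroup.PlacesOver L v => w'.1.adicCompletion L) w))).charpoly).IsRoot x) →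
        ∀ (E' : Type) [Field E'] [NumberField E'] [Algebra L E'] [Algebra.IsQuadraticExtension L E'] (c₁ : E' ≃ₐ[L] E') (δ : E') (m₀ : L)
          (s : (w.1.adicCompletion L)) (w₁ : UnitaryGroup.PlacesOver E' w.1) (hw₁ : c₁ • w₁.1 = w₁.1)
          (Θ : (w₁.1.adicCompletion E') →+* (w₁.1.adicCompletion E')) (α lam : (w₁.1.adicCompletion E')),
          c₁ ≠ 1 → c₁ δ = -δ → δ ≠ 0 → algebraMap L E' m₀ = δ ^ 2 → s ≠ 0 →
          (((γH.1.val : GL (Fin 2) (UnitaryGroup.LocalRing L v)).val.map (Pi.evalRingHom (fun w' : UnitaryGroup.PlacesOver L v => w'.1.adicCompletion L) w))).trace * (((γH.1.val : GL (Fin 2) (UnitaryGroup.LocalRing L v)).val.map (Pi.evalRingHom (fun w' : UnitaryGroup.PlacesOver L v => w'.1.adicCompletion L) w))).trace - 4 * (((γH.1.val : GL (Fin 2) (UnitaryGroup.LocalRing L v)).val.map (Pi.evalRingHom (fun w' : UnitaryGroup.PlacesOver L v => w'.1.adicCompletion L) w))).det = s * s * ((m₀ : L) : (w.1.adicCompletion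 L)) →
          (((γH.1.val : GL (Fin 2) (UnitaryGroup.LocalRing L v)).val.map (Pi.evalRingHom (fun w' : UnitaryGroup.PlacesOver L v => w'.1.adicCompletion L) w))).det * (galAdicCompletionMap (L := L) (IsCMField.complexConj L) hw) (((γH.1.val : GL (Fin 2) (UnitaryGroup.LocalRing L v)).val.map (Pi.evalRingHom (fun w' : UnitaryGroup.PlacesOver L v => w'.1.adicCompletion L) w))).det = 1 → (((γH.1.val : GL (Fin 2) (UnitaryGroup.LocalRing L v)).val.map (Pi.evalRingHom (fun w' : UnitaryGroup.PlacesOver L v => w'.1.adicCompletion L) w))).trace = (((γH.1.val : GL (Fin 2) (UnitaryGroup.LocalRing L v)).val.map (Pi.evalRingHom (fun w' : UnitaryGroup.PlacesOver L v => w'.1.adicCompletion L) w))).det * (galAdicCompletionMap (L := L) (IsCMField.complexConj L) hw) (((γH.1.val : GL (Fin 2) (UnitaryGroup.LocalRing L v)).val.map (Pi.evalRingHom (fun w' : UnitaryGroup.PlacesOver L v => w'.1.adicCompletion L) w))).trace →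
          (∀ x : (w.1.adicCompletion L), x * x - (((γH.1.val : GL (Fin 2) (UnitaryGroup.LocalRing L v)).val.map (Pi.evalRingHom (fun w' : UnitaryGroup.PlacesOver L v => w'.1.adicCompletion L) w))).trace * x + (((γH.1.val : GL (Fin 2) (UnitaryGroup.LocalRing L v)).val.map (Pi.evalRingHom (fun w' : UnitaryGroup.PlacesOver L v => w'.1.adicCompletion L) w))).det ≠ 0) →
          (∀ z, galAdicCompletionMap (L := E') c₁ hw₁ (galAdicCompletionMap (L := E') c₁ hw₁ z) = z) →
          (∀ z, Valued.v (galAdicCompletionMap (L := E') c₁ hw₁ z) = Valued.v z) →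
          (∀ a, galAdicCompletionMap (L := E') c₁ hw₁ (toPlace w.1 w₁ a) = toPlace w.1 w₁ a) →
          (∀ a, Valued.v (toPlace w.1 w₁ a) ≤ 1 ↔ Valued.v a ≤ 1) →
          (∀ z : (w₁.1.adicCompletion E'), galAdicCompletionMap (L := E') c₁ hw₁ z = z ↔ ∃ a, toPlace w.1 w₁ a = z) →
          (∀ a, Θ (toPlace w.1 w₁ a) = toPlace w.1 w₁ ((galAdicCompletionMap (L := L) (IsCMField.complexConj L) hw) a)) →
          (∀ z, Θ (Θ z) = z) →
          (∀ z, Θ (galAdicCompletionMap (L := E') c₁ hw₁ z) = galAdicCompletionMap (L := E') c₁ hw₁ (Θ z)) →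
          (∀ z, Valued.v (Θ z) = Valued.v z) →
          galAdicCompletionMap (L := E') c₁ hw₁ α ≠ α →
          Valued.v α ≤ 1 →
          (∀ z : (w₁.1.adicCompletion E'), Valued.v z ≤ 1 → Valued.v ((z - galAdicCompletionMap (L := E') c₁ hw₁ z) / (α - galAdicCompletionMap (L := E') c₁ hw₁ α)) ≤ 1) →
          2 * lam = toPlace w.1 w₁ (((γH.1.val : GL (Fin 2) (UnitaryGroup.LocalRing L v)).val.map (Pi.evalRingHom (fun w' : UnitaryGroup.PlacesOver L v => w'.1.adicCompletion L) w))).trace + toPlace w.1 w₁ s * ((δ : E') : (w₁.1.adicCompletion E')) →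
          lam * lam = toPlace w.1 w₁ (((γH.1.val : GL (Fin 2) (UnitaryGroup.LocalRing L v)).val.map (Pi.evalRingHom (fun w' : UnitaryGroup.PlacesOver L v => w'.1.adicCompletion L) w))).trace * lam - toPlace w.1 w₁ (((γH.1.val : GL (Fin 2) (UnitaryGroup.LocalRing L v)).val.map (Pi.evalRingHom (fun w' : UnitaryGroup.PlacesOver L v => w'.1.adicCompletion L) w))).det →
          galAdicCompletionMap (L := E') c₁ hw₁ lam = toPlace w.1 w₁ (((γH.1.val : GL (Fin 2) (UnitaryGroup.LocalRing L v)).val.map (Pi.evalRingHom (fun w' : UnitaryGroup.PlacesOver L v => w'.1.adicCompletion L) w))).trace - lam →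
          Θ lam * lam = 1 →
          Valued.v lam = 1 →
          (∀ z : (w₁.1.adicCompletion E'), ∃! pq : (w.1.adicCompletion L) × (w.1.adicCompletion L), z = toPlace w.1 w₁ pq.1 + toPlace w.1 w₁ pq.2 * lam) →
          Valued.v (α - (galAdicCompletionMap (L := E') c₁ hw₁) α) < 1 →
          ∀ (th ta : ((UnitaryGroup.cmDatum L 3 (Matrix.of fun i j : Fin 3 => if i.val + j.val + 1 = 3 then (1 : L) else 0)).Local v)) (P₁ : GL (Fin 3) (w.1.adicCompletion L)) (dg : Fin 2 → (w.1.adicCompletion L)) (η : (w.1.adicCompletion L)) (γ₁ : GL (Fin 2) (w.1.adicCompletion L)),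
            ((localNonsplitEquiv (IsCMField.complexConj L) (Matrix.of fun i j : Fin 3 => if i.val + j.val + 1 = 3 then (1 : L) else 0) (IsCMField.complexConj_ne_one L) w hw th : ↥(unitaryGroupOfForm (galAdicCompletionMap (L := L) (IsCMField.complexConj L) hw) (placeForm (Matrix.of fun i j : Fin 3 => if i.val + j.val + 1 = 3 then (1 : L) else 0) w.1))) : GL (Fin 3) (w.1.adicCompletion L)) = endoGL (((localNonsplitEquiv (IsCMField.complexConj L) (Matrix.of fun i j : Fin 2 => if i.val + j.val + 1 = 2 then (1 : L) else 0) (IsCMField.complexConj_ne_one L) w hw γH.1 : ↥(unitaryGroupOfForm (galAdicCompletionMap (L := L) (IsCMField.complexConj L) hw) (placeForm (Matrix.of fun i j : Fin 2 => if i.val + j.val + 1 = 2 then (1 : L) else 0) w.1))) : GL (Fin 2) (w.1.adicCompletion L)), ((localNonsplitEquiv (IsCMField.complexConj L) (Matrix.of fun i j : Fin 1 => if i.val + j.val + 1 = 1 then (1 : L) else 0) (IsCMField.complexConj_ne_one L) w hw γH.2).val : GL (Fin 1) (w.1.adicCompletion L))) →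
            ((localNonsplitEquiv (IsCMField.complexConj L) (Matrix.of fun i j : Fin 3 => if i.val + j.val + 1 = 3 then (1 : L) else 0) (IsCMField.complexConj_ne_one L) w hw ta : ↥(unitaryGroupOfForm (galAdicCompletionMap (L := L) (IsCMField.complexConj L) hw) (placeForm (Matrix.of fun i j : Fin 3 => if i.val + j.val + 1 = 3 then (1 : L) else 0) w.1))) : GL (Fin 3) (w.1.adicCompletion L)) = P₁ * endoGL (γ₁, ((localNonsplitEquiv (IsCMField.complexConj L) (Matrix.of fun i j : Fin 1 => if i.val + j.val + 1 = 1 then (1 : L) else 0) (IsCMField.complexConj_ne_one L) w hw γH.2).val : GL (Fin 1) (w.1.adicCompletion L))) * P₁⁻¹ →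
            formCongr (galAdicCompletionMap (L := L) (IsCMField.complexConj L) hw) P₁ (placeForm (Matrix.of fun i j : Fin 3 => if i.val + j.val + 1 = 3 then (1 : L) else 0) w.1) = (!![(Matrix.diagonal dg) 0 0, 0, (Matrix.diagonal dg) 0 1; 0, η, 0; (Matrix.diagonal dg) 1 0, 0, (Matrix.diagonal dg) 1 1] : Matrix (Fin 3) (Fin 3) (w.1.adicCompletion L)) →
            (∀ i, Valued.v (dg i) = 1) →
            (∀ i, (galAdicCompletionMap (L := L) (IsCMField.complexConj L) hw) (dg i) = dg i) →
            (galAdicCompletionMap (L := L) (IsCMField.complexConj L) hw) η = η →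
            Valued.v η = 1 →
            (¬ ∃ t : (w.1.adicCompletion L), t * (galAdicCompletionMap (L := L) (IsCMField.complexConj L) hw) t = η) →
            γ₁ ∈ unitaryGroupOfForm (galAdicCompletionMap (L := L) (IsCMField.complexConj L) hw) (Matrix.diagonal dg) →
            (γ₁ : Matrix (Fin 2) (Fin 2) (w.1.adicCompletion L)).charpoly = (((γH.1.val : GL (Fin 2) (UnitaryGroup.LocalRing L v)).val.map (Pi.evalRingHom (fun w' : UnitaryGroup.PlacesOver L v => w'.1.adicCompletion L) w))).charpoly →
          ∀ (φ : (Fin 2 → (w.1.adicCompletion L)) →+ (w₁.1.adicCompletion E')) (h : (w₁.1.adicCompletion E')) (φ' : (Fin 2 → (w.1.adicCompletion L)) →+ (w₁.1.adicCompletion E')) (h' : (w₁.1.adicCompletion E')),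
            (∀ (c : (w.1.adicCompletion L)) (x : Fin 2 → (w.1.adicCompletion L)), φ (c • x) = toPlace w.1 w₁ c * φ x) →
            Function.Injective φ →
            Function.Surjective φ →
            (∀ x, φ ((((localNonsplitEquiv (IsCMField.complexConj L) (Matrix.of fun i j : Fin 2 => if i.val + j.val + 1 = 2 then (1 : L) else 0) (IsCMField.complexConj_ne_one L) w hw γH.1 : ↥(unitaryGroupOfForm (galAdicCompletionMap (L := L) (IsCMField.complexConj L) hw) (placeForm (Matrix.of fun i j : Fin 2 => if i.val + j.val + 1 = 2 then (1 : L) else 0) w.1))) : GL (Fin 2) (w.1.adicCompletion L)) : Matrix (Fin 2) (Fin 2) (w.1.adicCompletion L)).mulVec x) = lam * φ x) →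
            (∀ x y, toPlace w.1 w₁ (pairing (galAdicCompletionMap (L := L) (IsCMField.complexConj L) hw) (placeForm (Matrix.of fun i j : Fin 2 => if i.val + j.val + 1 = 2 then (1 : L) else 0) w.1) x y) = h * Θ (φ x) * φ y + galAdicCompletionMap (L := E') c₁ hw₁ (h * Θ (φ x) * φ y)) →
            Θ h = h →
            h ≠ 0 →
            (∃ x : (w₁.1.adicCompletion E'), x ≠ 0 ∧ h * Θ x * x + galAdicCompletionMap (L := E') c₁ hw₁ (h * Θ x * x) = 0) →
            (∀ (c : (w.1.adicCompletion L)) (x : Fin 2 → (w.1.adicCompletion L)), φ' (c • x) = toPlace w.1 w₁ c * φ' x) →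
            Function.Injective φ' →
            Function.Surjective φ' →
            (∀ x, φ' ((γ₁ : Matrix (Fin 2) (Fin 2) (w.1.adicCompletion L)).mulVec x) = lam * φ' x) →
            (∀ x y, toPlace w.1 w₁ (pairing (galAdicCompletionMap (L := L) (IsCMField.complexConj L) hw) (Matrix.diagonal dg) x y) = h' * Θ (φ' x) * φ' y + galAdicCompletionMap (L := E') c₁ hw₁ (h' * Θ (φ' x) * φ' y)) →
            Θ h' = h' →
            h' ≠ 0 →
            (∀ (t : (w.1.adicCompletion L)) (n : ℤ), Valued.v (toPlace w.1 w₁ t) = Valued.v (toPlace w.1 w₁ ϖ) ^ n ↔ Valued.v t = Valued.v ϖ ^ n) →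
            (∀ c : (w₁.1.adicCompletion E'), galAdicCompletionMap (L := E') c₁ hw₁ c = c → c ≠ 0 → Valued.v c ≤ 1 → ∃ n : ℕ, Valued.v c = Valued.v (toPlace w.1 w₁ ϖ) ^ n) →
            (∀ t : (w₁.1.adicCompletion E'), galAdicCompletionMap (L := E') c₁ hw₁ t = t → Valued.v t < 1 → Valued.v t ≤ Valued.v (toPlace w.1 w₁ ϖ)) →
              ∀ (J R R' : ℕ) (f f' : ℕ → ℕ → AddSubgroup (w₁.1.adicCompletion E') → ℕ),
              {M₃ : Submodule (Valued.integer (w.1.adicCompletion L)) (Fin 3 → (w.1.adicCompletion L)) | IsVertexLattice (galAdicCompletionMap (L := L) (IsCMField.complexConj L) hw) ϖ ((StdForm.antidiagonal 3).over (w.1.adicCompletion L)) 0 M₃ ∧ mapGL (endoGL (((localNonsplitEquiv (IsCMField.complexConj L) (Matrix.of fun i j : Fin 2 => if i.val + j.val + 1 = 2 then (1 : L) else 0) (IsCMField.complexConj_ne_one L) w hw γH.1 : ↥(unitaryGroupOfForm (galAdicCompletionMap (L := L) (IsCMField.complexConj L) hw) (placeForm (Matrix.of fun i j : Fin 2 =>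 if i.val + j.val + 1 = 2 then (1 : L) else 0) w.1))) : GL (Fin 2) (w.1.adicCompletion L)), ((localNonsplitEquiv (IsCMField.complexConj L) (Matrix.of fun i j : Fin 1 => if i.val + j.val + 1 = 1 then (1 : L) else 0) (IsCMField.complexConj_ne_one L) w hw γH.2).val : GL (Fin 1) (w.1.adicCompletion L)))) M₃ = M₃}.Finite →
              (∀ M₃ : Submodule (Valued.integer (w.1.adicCompletion L)) (Fin 3 → (w.1.adicCompletion L)), IsVertexLattice (galAdicCompletionMap (L := L) (IsCMField.complexConj L) hw) ϖ ((StdForm.antidiagonal 3).over (w.1.adicCompletion L)) 0 M₃ → mapGL (endoGL (((localNonsplitEquiv (IsCMField.complexConj L) (Matrix.of fun i j : Fin 2 => if i.val + j.val + 1 = 2 then (1 : L) else 0) (IsCMField.complexConj_ne_one L) w hw γH.1 : ↥(unitaryGroupOfForm (galAdicCompletionMap (L := L) (IsCMField.complexConj L) hw) (placeForm (Matrix.of fun i j : Fin 2 => if i.val + j.val + 1 = 2 then (1 : L) else 0) w.1))) : GL (Fin 2) (w.1.adicCompletion L)), ((localNonsplitEquiv (IsCMField.complexConj L) (Matrix.of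 fun i j : Fin 1 => if i.val + j.val + 1 = 1 then (1 : L) else 0) (IsCMField.complexConj_ne_one L) w hw γH.2).val : GL (Fin 1) (w.1.adicCompletion L)))) M₃ = M₃ →
                ∀ b : ℕ, (∀ c : (w.1.adicCompletion L), (Pi.single 1 c : Fin 3 → (w.1.adicCompletion L)) ∈ M₃ ↔ Valued.v c ≤ Valued.v ϖ ^ b) → b ≤ R) →
              {M₃ : Submodule (Valued.integer (w.1.adicCompletion L)) (Fin 3 → (w.1.adicCompletion L)) | IsSelfDualLattice (galAdicCompletionMap (L := L) (IsCMField.complexConj L) hw) ϖ (!![(Matrix.diagonal dg) 0 0, 0, (Matrix.diagonal dg) 0 1; 0, η, 0; (Matrix.diagonal dg) 1 0, 0, (Matrix.diagonal dg) 1 1] : Matrix (Fin 3) (Fin 3) (w.1.adicCompletion L)) M₃ ∧ mapGL (endoGL (γ₁, ((localNonsplitEquiv (IsCMField.complexConj L) (Matrix.of fun i j : Fin 1 => if i.val + j.val + 1 = 1 then (1 : L) else 0) (IsCMField.complexConj_ne_one L) w hw γH.2).val : GL (Fin 1) (w.1.adicCompletion L)))) M₃ = M₃}.Finite →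
              (∀ M₃ : Submodule (Valued.integer (w.1.adicCompletion L)) (Fin 3 → (w.1.adicCompletion L)), IsSelfDualLattice (galAdicCompletionMap (L := L) (IsCMField.complexConj L) hw) ϖ (!![(Matrix.diagonal dg) 0 0, 0, (Matrix.diagonal dg) 0 1; 0, η, 0; (Matrix.diagonal dg) 1 0, 0, (Matrix.diagonal dg) 1 1] : Matrix (Fin 3) (Fin 3) (w.1.adicCompletion L)) M₃ → mapGL (endoGL (γ₁, ((localNonsplitEquiv (IsCMField.complexConj L) (Matrix.of fun i j : Fin 1 => if i.val + j.val + 1 = 1 then (1 : L) else 0) (IsCMField.complexConj_ne_one L) w hw γH.2).val : GL (Fin 1) (w.1.adicCompletion L)))) M₃ = M₃ →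
                ∀ b : ℕ, (∀ c : (w.1.adicCompletion L), (Pi.single 1 c : Fin 3 → (w.1.adicCompletion L)) ∈ M₃ ↔ Valued.v c ≤ Valued.v ϖ ^ b) → b ≤ R') →
              ¬ IsOrd (galAdicCompletionMap (L := E') c₁ hw₁) α (toPlace w.1 w₁ ϖ ^ (J + 1)) lam →
              (∀ j a, (levelSet (galAdicCompletionMap (L := E') c₁ hw₁) Θ α (toPlace w.1 w₁ ϖ) h j a).Finite) →
              (∀ j a, (levelSet (galAdicCompletionMap (L := E') c₁ hw₁) Θ α (toPlace w.1 w₁ ϖ) h' j a).Finite) →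
              Valued.v ((((localNonsplitEquiv (IsCMField.complexConj L) (Matrix.of fun i j : Fin 1 => if i.val + j.val + 1 = 1 then (1 : L) else 0) (IsCMField.complexConj_ne_one L) w hw γH.2).val : GL (Fin 1) (w.1.adicCompletion L)) : Matrix (Fin 1) (Fin 1) (w.1.adicCompletion L)) 0 0) = 1 →
              (∀ (b j : ℕ) (Λ : AddSubgroup (w₁.1.adicCompletion E')) (x₀ : (w₁.1.adicCompletion E')) (r : (w.1.adicCompletion L)), 1 ≤ b → x₀ ≠ 0 →
                (∀ x, x ∈ Λ ↔ ∃ z, IsOrd (galAdicCompletionMap (L := E') c₁ hw₁) α (toPlace w.1 w₁ ϖ ^ j) z ∧ x = x₀ * z) →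
                IsOrd (galAdicCompletionMap (L := E') c₁ hw₁) α (toPlace w.1 w₁ ϖ ^ j) (dualGen (galAdicCompletionMap (L := E') c₁ hw₁) Θ α (toPlace w.1 w₁ ϖ ^ j) h x₀) → ¬ IsOrd (galAdicCompletionMap (L := E') c₁ hw₁) α (toPlace w.1 w₁ ϖ ^ j) (dualGen (galAdicCompletionMap (L := E') c₁ hw₁) Θ α (toPlace w.1 w₁ ϖ ^ j) h x₀ / toPlace w.1 w₁ ϖ) →
                Valued.v (dualGen (galAdicCompletionMap (L := E') c₁ hw₁) Θ α (toPlace w.1 w₁ ϖ ^ j) h x₀) = Valued.v (toPlace w.1 w₁ ϖ) ^ b →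
                (∀ b', (∀ x ∈ Λ, Valued.v (h * Θ x * b' + galAdicCompletionMap (L := E') c₁ hw₁ (h * Θ x * b')) ≤ 1) → (lam - toPlace w.1 w₁ ((((localNonsplitEquiv (IsCMField.complexConj L) (Matrix.of fun i j : Fin 1 => if i.val + j.val + 1 = 1 then (1 : L) else 0) (IsCMField.complexConj_ne_one L) w hw γH.2).val : GL (Fin 1) (w.1.adicCompletion L)) : Matrix (Fin 1) (Fin 1) (w.1.adicCompletion L)) 0 0)) * b' ∈ Λ) →
                IsOrd (galAdicCompletionMap (L := E') c₁ hw₁) α (toPlace w.1 w₁ ϖ ^ j) lam → toPlace w.1 w₁ r = glueUnit (galAdicCompletionMap (L := E') c₁ hw₁) Θ α (toPlace w.1 w₁ ϖ ^ j) h (toPlace w.1 w₁ ϖ) (toPlace w.1 w₁ 1) x₀ b →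
                f b j Λ = Nat.card {x : 𝒪[(w.1.adicCompletion L)] ⧸ 𝓂[(w.1.adicCompletion L)] ^ (2 * b) // ∃ u' : 𝒪[(w.1.adicCompletion L)], Ideal.Quotient.mk (𝓂[(w.1.adicCompletion L)] ^ (2 * b)) u' = x ∧
                  Valued.v ((u' : (w.1.adicCompletion L)) * (galAdicCompletionMap (L := L) (IsCMField.complexConj L) hw) u' - r) ≤ Valued.v (ϖ ^ (2 * b))}) →
              (∀ (b j : ℕ) (Λ : AddSubgroup (w₁.1.adicCompletion E')) (x₀ : (w₁.1.adicCompletion E')) (r : (w.1.adicCompletion L)), 1 ≤ b → x₀ ≠ 0 →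
                (∀ x, x ∈ Λ ↔ ∃ z, IsOrd (galAdicCompletionMap (L := E') c₁ hw₁) α (toPlace w.1 w₁ ϖ ^ j) z ∧ x = x₀ * z) →
                IsOrd (galAdicCompletionMap (L := E') c₁ hw₁) α (toPlace w.1 w₁ ϖ ^ j) (dualGen (galAdicCompletionMap (L := E') c₁ hw₁) Θ α (toPlace w.1 w₁ ϖ ^ j) h' x₀) → ¬ IsOrd (galAdicCompletionMap (L := E') c₁ hw₁) α (toPlace w.1 w₁ ϖ ^ j) (dualGen (galAdicCompletionMap (L := E') c₁ hw₁) Θ α (toPlace w.1 w₁ ϖ ^ j) h' x₀ / toPlace w.1 w₁ ϖ) →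
                Valued.v (dualGen (galAdicCompletionMap (L := E') c₁ hw₁) Θ α (toPlace w.1 w₁ ϖ ^ j) h' x₀) = Valued.v (toPlace w.1 w₁ ϖ) ^ b →
                (∀ b', (∀ x ∈ Λ, Valued.v (h' * Θ x * b' + galAdicCompletionMap (L := E') c₁ hw₁ (h' * Θ x * b')) ≤ 1) → (lam - toPlace w.1 w₁ ((((localNonsplitEquiv (IsCMField.complexConj L) (Matrix.of fun i j : Fin 1 => if i.val + j.val + 1 = 1 then (1 : L) else 0) (IsCMField.complexConj_ne_one L) w hw γH.2).val : GL (Fin 1) (w.1.adicCompletion L)) : Matrix (Fin 1) (Fin 1) (w.1.adicCompletion L)) 0 0)) * b' ∈ Λ) →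
                IsOrd (galAdicCompletionMap (L := E') c₁ hw₁) α (toPlace w.1 w₁ ϖ ^ j) lam → toPlace w.1 w₁ r = glueUnit (galAdicCompletionMap (L := E') c₁ hw₁) Θ α (toPlace w.1 w₁ ϖ ^ j) h' (toPlace w.1 w₁ ϖ) (toPlace w.1 w₁ η) x₀ b →
                f' b j Λ = Nat.card {x : 𝒪[(w.1.adicCompletion L)] ⧸ 𝓂[(w.1.adicCompletion L)] ^ (2 * b) // ∃ u' : 𝒪[(w.1.adicCompletion L)], Ideal.Quotient.mk (𝓂[(w.1.adicCompletion L)] ^ (2 * b)) u' = x ∧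
                  Valued.v ((u' : (w.1.adicCompletion L)) * (galAdicCompletionMap (L := L) (IsCMField.complexConj L) hw) u' - r) ≤ Valued.v (ϖ ^ (2 * b))}) →
            (∀ f₀ : (w₁.1.adicCompletion E'), galAdicCompletionMap (L := E') c₁ hw₁ f₀ = f₀ → Θ f₀ = f₀ → Valued.v f₀ = 1 → ∃ z : (w₁.1.adicCompletion E'), z * Θ z = f₀) ∧
            (∀ (m : ℕ) (β : (v.adicCompletion ↥(maximalRealSubfield L))ˣ), Valued.v (((finCharpolyTwo L v γH).eval (finGammaTwo L v γH)) w) = Valued.v ((toPlace v w (HeckeCharacter.uniformizer ↥(maximalRealSubfield L) v : v.adicCompletion ↥(maximalRealSubfield L))) ^ m) →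
              toPlace v w (β : (v.adicCompletion ↥(maximalRealSubfield L))) = -(((finCharpolyTwo L v γH).eval (finGammaTwo L v γH)) w * (finGammaTwo L v γH w ^ 2 + ((γH.1.val.val : Matrix (Fin 2) (Fin 2) (UnitaryGroup.LocalRing L v)).map (Pi.evalRingHom (fun w' : UnitaryGroup.PlacesOver L v => w'.1.adicCompletion L) w)).det)) / (2 * finGammaTwo L v γH w ^ 2 * ((γH.1.val.val : Matrix (Fin 2) (Fin 2) (UnitaryGroup.LocalRing L v)).map (Pi.evalRingHom (fun w' : UnitaryGroup.PlacesOver L v => w'.1.adicCompletion L) w)).det) →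
              (((Fintype.card (Valued.ResidueField (w.1.adicCompletion L))) : ℤ) - 1) * ((((∑ j ∈ Finset.range (J + 1), (if IsOrd (galAdicCompletionMap (L := E') c₁ hw₁) α (toPlace w.1 w₁ ϖ ^ j) lam then (levelSet (galAdicCompletionMap (L := E') c₁ hw₁) Θ α (toPlace w.1 w₁ ϖ) h j 0).ncard else 0)) + ∑ b ∈ Finset.Icc 1 R, ∑ j ∈ Finset.range (J + 1), (if IsOrd (galAdicCompletionMap (L := E') c₁ hw₁) α (toPlace w.1 w₁ ϖ ^ j) lam then Nat.card 𝓀[(w.1.adicCompletion L)] ^ b * (levelSetDep (galAdicCompletionMap (L := E') c₁ hw₁) Θ α (toPlace w.1 w₁ ϖ) h j b (lam - toPlace w.1 w₁ ((((localNonsplitEquiv (IsCMField.complexConj L) (Matrix.of fun i j : Fin 1 => if i.val + j.val + 1 = 1 then (1 : L) else 0) (IsCMField.complexConj_ne_one L) w hw γH.2).val : GL (Fin 1) (w.1.adicCompletion L)) : Matrix (Fin 1) (Fin 1) (w.1.adicCompletion L)) 0 0))).ncard else 0) : ℕ) : ℤ) - (((∑ j ∈ Finset.range (J + 1), (if IsOrd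 (galAdicCompletionMap (L := E') c₁ hw₁) α (toPlace w.1 w₁ ϖ ^ j) lam then (levelSet (galAdicCompletionMap (L := E') c₁ hw₁) Θ α (toPlace w.1 w₁ ϖ) h' j 0).ncard else 0)) + ∑ b ∈ Finset.Icc 1 R', ∑ j ∈ Finset.range (J + 1), (if IsOrd (galAdicCompletionMap (L := E') c₁ hw₁) α (toPlace w.1 w₁ ϖ ^ j) lam then Nat.card 𝓀[(w.1.adicCompletion L)] ^ b * (levelSetDep (galAdicCompletionMap (L := E') c₁ hw₁) Θ α (toPlace w.1 w₁ ϖ) h' j b (lam - toPlace w.1 w₁ ((((localNonsplitEquiv (IsCMField.complexConj L) (Matrix.of fun i j : Fin 1 => if i.val + j.val + 1 = 1 then (1 : L) else 0) (IsCMField.complexConj_ne_one L) w hw γH.2).val : GL (Fin 1) (w.1.adicCompletion L)) : Matrix (Fin 1) (Fin 1) (w.1.adicCompletion L)) 0 0))).ncard else 0) : ℕ) : ℤ)) = (Literature.NumberTheory.QuadraticForms.hilbertSymbol (v.adicCompletion ↥(maximalRealSubfield L)) (β : (v.adicCompletion ↥(maximalRealSubfield L))) (algebraMap ↥(maximalRealSubfield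 L) _ ((cmQuadraticGenerator L : 𝓞 ↥(maximalRealSubfield L)) : ↥(maximalRealSubfield L))) : ℤ) * ((Fintype.card (Valued.ResidueField (w.1.adicCompletion L))) : ℤ) ^ m * ((((Fintype.card (Valued.ResidueField (w.1.adicCompletion L))) : ℤ) - 1) * (((Nat.card (MulAction.fixedBy (((UnitaryGroup.cmDatum L 2 (Matrix.of fun i j : Fin 2 => if i.val + j.val + 1 = 2 then (1 : L) else 0)).Local v) ⧸ cmLocalIntegralLevel L 2 (Matrix.of fun i j : Fin 2 => if i.val + j.val + 1 = 2 then (1 : L) else 0) v) γH.1)) + d % 2 : ℕ) : ℤ) - 2 * (((Fintype.card (Valued.ResidueField (w.1.adicCompletion L))) : ℤ) ^ (d - d % 2) - 1)))   := by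
  classical
  have hc1 : IsCMField.complexConj L ≠ 1 := IsCMField.complexConj_ne_one L
  have hϖ0 : ϖ ≠ 0 := fun h0 => by rw [h0, map_zero] at hϖ; exact WithZero.zero_ne_coe hϖ
  have h20 : (2 : w.1.adicCompletion L) ≠ 0 := two_ne_zero_adicCompletion L v w
  -- THE TUBE `V`: every m-token is `≥ 3d + 3tE + 2` (★ p858075) AND the plane block is `≡ 1 (mod ϖ^{2tE+2})` (★ p858116) — the latter gives p09's `htube`
  obtain ⟨V₁, hV₁, hV₁all⟩ := exists_nhds_one_le_tokenDepth L v w (3 * d + 3 * tE + 2)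
  have hc0 : (ϖ ^ (2 * tE + 2) : w.1.adicCompletion L) ≠ 0 := pow_ne_zero _ hϖ0
  obtain ⟨V₂, hV₂, hV₂all⟩ := exists_nhds_one_block_congr L v w (c := ϖ ^ (2 * tE + 2)) hc0
  refine ⟨V₁ ∩ V₂, Filter.inter_mem hV₁ hV₂, fun γH hγ hreg hirr E' _ _ _ _ c₁ δ m₀ s w₁ hw₁ Θ α lam hc₁1 hc₁δ hδ0 hmδ hs hΔ hDσ htσ hirr'
    hρρ hvρ hρj hjle1 hjfix hΘj hΘΘ hΘρ hvΘ hρα hα1 hint h2lam hlam2 hρlam hΘlam hvlam huniq hαC => ?_⟩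
  intro th ta P₁ dg η γ₁ hth hta hform hdg1 hdgσ hησ hη1 hηN hγ₁U hγ₁χ φ h φ' h' hφc hφi hφs hφγ hφH hΘh hh hhyper
    hφ'c hφ'i hφ's hφ'γ hφ'H hΘh' hh' hjpow hfixpow hsmall J R R' f f' hfinV hRV hfinS hRS hJ hfinLS hfinLS' hu1 hf hf'
  haveI : Finite 𝓀[w₁.1.adicCompletion E'] := finite_residueField_adicCompletion E' w₁.1
  -- abbreviations: `ρ' = c₁` on `M`, `ιw = ι_{w₁}`, `τ := Θ ∘ ρ'`
  set ρ' : (w₁.1.adicCompletion E') →+* (w₁.1.adicCompletion E') := galAdicCompletionMap (L := E') c₁ hw₁ with hρ'def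
  set ιw : (w.1.adicCompletion L) →+* (w₁.1.adicCompletion E') := toPlace w.1 w₁ with hιwdef
  set τ : (w₁.1.adicCompletion E') →+* (w₁.1.adicCompletion E') := Θ.comp ρ' with hτdef
  have hτ : ∀ x, τ x = Θ (ρ' x) := fun x => rfl
  -- (C-0″) THE FRAME AT THE UNIFORMISER (★ p858468, this seat): `ϖM` with `α − ρ'α = ϖM − ρ'ϖM`, the three data, the residual trivialities, the `Θ`-unit dichotomy,
  -- the norm clause (i), the anchor `n₀`, `hF4`, the Σ2 unit `hf`, and the dictionary `dΘ = 2g`, `dτ = 2s0`, `g + s0 = d`, `2dK = dρ + 2g`, `2d′ = dρ + dτ` (★ p858086 p858066 p857943 p858161 p858318)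
  obtain ⟨ϖM, c₀, n₀, dρ, dΘ, dτ, g, s0, dK, d', hjE2, hqM, hΘres, hτres, hϖM, hαϖM, hDρ, hDΘ, hdτ1, hdτv, hΘc₀, hc₀, hdich, hFNM, hΘn₀, hn₀1, hn₀N,
      hF4τ, hF4, hfS2, hg2, hs02, hg1, hs01, hgs, hdKv, hdK2, hd'v, hd'2⟩ :=
    exists_uniformiser_frame_ramM L w hw E' c₁ w₁ hw₁ hc₁1 he hD ρ' Θ τ hρ'def hτ hρρ hvρ hρα hα1 hint hjle1 hjfix hΘj hΘΘ hΘρ hvΘ hαC hirr' hlam2 hΘlam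
  refine ⟨hFNM, ?_⟩
  -- THE CENSUS IDENTITY
  intro m β hmtok hβ
  have hm0 : 3 * d + 3 * tE + 2 ≤ m := hV₁all γH (Set.mem_of_mem_inter_left hγ) m hmtok
  obtain ⟨hblock, hublk⟩ := hV₂all γH (Set.mem_of_mem_inter_right hγ)
  have hdρv : Valued.v (ϖM - ρ' ϖM) = Valued.v ϖM ^ dρ := hDρ.2.2.2.2.1
  -- the `U(1)`-token `u := ιw u₀`
  set u₀ : (w.1.adicCompletion L) := (((localNonsplitEquiv (IsCMField.complexConj L) (Matrix.of fun i j : Fin 1 => if i.val + j.val + 1 = 1 then (1 : L) else 0)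
      (IsCMField.complexConj_ne_one L) w hw γH.2).val : GL (Fin 1) (w.1.adicCompletion L)) : Matrix (Fin 1) (Fin 1) (w.1.adicCompletion L)) 0 0 with hu₀def
  set qw : ℕ := Nat.card 𝓀[w.1.adicCompletion L] with hqwdef
  have hqw : qw = Fintype.card (Valued.ResidueField (w.1.adicCompletion L)) := Nat.card_eq_fintype_card
  have hΦ1 : IsUnit ((placeForm (Matrix.of fun i j : Fin 1 => if i.val + j.val + 1 = 1 then (1 : L) else 0) w.1) 0 0) := by
    rw [placeForm_antidiagOne]; simp [StdForm.over, StdForm.antidiagonal]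
  have hu₀1 : (galAdicCompletionMap (L := L) (IsCMField.complexConj L) hw) u₀ * u₀ = 1 :=
    mul_map_eq_one_of_mem_unitary_one (galAdicCompletionMap (L := L) (IsCMField.complexConj L) hw) hΦ1
      (localNonsplitEquiv (IsCMField.complexConj L) (Matrix.of fun i j : Fin 1 => if i.val + j.val + 1 = 1 then (1 : L) else 0)
        (IsCMField.complexConj_ne_one L) w hw γH.2).2
  obtain ⟨hu, hu1'⟩ := map_fixed_and_mul_map_eq_one (galAdicCompletionMap (L := L) (IsCMField.complexConj L) hw) ιw hΘj hjfix hu₀1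
  -- datum letters at `M`: `ϖE := ιw ϖ`, `|ϖE| = exp(−2)`
  have hϖE : Valued.v (ιw ϖ) = WithZero.exp (-2 : ℤ) := by rw [hjE2, hϖ, ← WithZero.exp_nsmul]; rfl
  have hϖE0 : ιw ϖ ≠ 0 := fun h0 => by rw [h0, map_zero] at hϖE; exact WithZero.zero_ne_coe hϖE
  have hϖE1 : Valued.v (ιw ϖ) < 1 := by rw [hϖE, ← WithZero.exp_zero, WithZero.exp_lt_exp]; norm_num
  have hρϖ : ρ' (ιw ϖ) = ιw ϖ := hρj ϖ
  have hvαϖ : Valued.v (α - ρ' α) = Valued.v (ϖM - ρ' ϖM) := by rw [hαϖM]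
  -- `jl`: the conductor level of `lam` (`(lam − ρ'lam)∕(α − ρ'α)` is `ρ'`-fixed and integral, hence of even order `2jl`)
  obtain ⟨jl, hjl⟩ : ∃ jl : ℕ, Valued.v (lam - ρ' lam) = Valued.v (ιw ϖ ^ jl * (ϖM - ρ' ϖM)) := by
    have hb : lam - ρ' lam = (lam - ρ' lam) / (α - ρ' α) * (α - ρ' α) := (div_mul_cancel₀ _ (sub_ne_zero.2 (Ne.symm hρα))).symm
    have hρb : ρ' ((lam - ρ' lam) / (α - ρ' α)) = (lam - ρ' lam) / (α - ρ' α) := by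
      rw [map_div₀, map_sub, map_sub, hρρ, hρρ, ← neg_sub lam, ← neg_sub α, neg_div_neg_eq]
    have hb0 : (lam - ρ' lam) / (α - ρ' α) ≠ 0 := fun h0 => by   -- `lam = ρ'lam` contradicts irreducibility
      obtain ⟨a, ha⟩ := (hjfix lam).1 (sub_eq_zero.1 (by rw [hb, h0, zero_mul])).symm
      exact hirr' a ((map_eq_zero_iff ιw (RingHom.injective ιw)).1 (by rw [map_add, map_sub, map_mul, map_mul, ha]; linear_combination hlam2))
    obtain ⟨n, hn⟩ := hfixpow _ hρb hb0 (hint lam hvlam.le)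
    exact ⟨n, by rw [hb, map_mul, map_mul, map_pow, hn, hvαϖ]⟩
  have hjlμ : Valued.v ((lam - ιw u₀) - ρ' (lam - ιw u₀)) = Valued.v (ιw ϖ ^ jl * (ϖM - ρ' ϖM)) := by
    rw [ρ'.map_sub, hu, sub_sub_sub_cancel_right, hjl]
  -- the m-token on `M`: `|lam − u| = exp(−2m) = |ϖE|^m` (★ p858173 bridge + `v_sub_eq_exp_of_token_ramM`)
  have hmexp : Valued.v (lam - ιw u₀) = WithZero.exp (-(2 * (m : ℤ))) :=
    v_sub_eq_exp_of_token_ramM ιw hjE2 hvρ hjfix hρlam hlam2 u₀ (valued_quadratic_of_mtoken L w hw γH he hmtok)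
  have hjlexp : Valued.v ((lam - ιw u₀) - ρ' (lam - ιw u₀)) = WithZero.exp (-(2 * (jl : ℤ) + dρ)) := by
    rw [hjlμ, map_mul, map_pow, hϖE, hdρv, hϖM, ← WithZero.exp_nsmul, ← WithZero.exp_nsmul, ← WithZero.exp_add]; congr 1; simp only [nsmul_eq_mul]; ring
  obtain ⟨hμ, -⟩ := tokens_pow_of_exp (ρ := ρ') hϖE hDρ hmexp hjlexp
  -- (C-5c) S6b-RM: the parity-or-window token and `m ≤ jl` (this seat)
  have hω : Valued.v (ιw (ϖ - (galAdicCompletionMap (L := L) (IsCMField.complexConj L) hw) ϖ)) = WithZero.exp (-(2 * ((g + s0 : ℕ) : ℤ))) := by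
    rw [hjE2, hD.2.2.2.2.1, hϖ, hgs, ← WithZero.exp_nsmul, ← WithZero.exp_nsmul]; congr 1; simp only [nsmul_eq_mul]; ring
  have hρω : ρ' (ιw (ϖ - (galAdicCompletionMap (L := L) (IsCMField.complexConj L) hw) ϖ)) = ιw (ϖ - (galAdicCompletionMap (L := L) (IsCMField.complexConj L) hw) ϖ) := hρj _
  have hΘω : Θ (ιw (ϖ - (galAdicCompletionMap (L := L) (IsCMField.complexConj L) hw) ϖ)) = -ιw (ϖ - (galAdicCompletionMap (L := L) (IsCMField.complexConj L) hw) ϖ) := by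
    rw [hΘj, map_sub, hD.1, ← map_neg, neg_sub]
  have h2M : Valued.v (2 : w₁.1.adicCompletion E') = WithZero.exp (-(2 * (tE : ℤ))) := by
    rw [show (2 : w₁.1.adicCompletion E') = ιw 2 from (map_ofNat ιw 2).symm, hjE2, hD.2.2.2.2.2.2, hϖ, ← WithZero.exp_nsmul, ← WithZero.exp_nsmul]
    congr 1; simp only [nsmul_eq_mul]; ring
  have hΘP : Θ (ϖM * Θ ϖM) = ϖM * Θ ϖM := by rw [map_mul, hΘΘ, mul_comm]
  have hP : Valued.v (ϖM * Θ ϖM) = WithZero.exp (-2 : ℤ) := by rw [map_mul, hvΘ, hϖM, ← WithZero.exp_add]; rfl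
  have hdρle : dρ ≤ 2 * tE + 1 :=
    Literature.NumberTheory.LocalFields.WildQuadraticDatum.d_le_succ_t hDρ.1 hDρ.2.2.2.1 hDρ.2.2.1 hDρ.2.2.2.2.1 hDρ.2.2.2.2.2.2
  obtain ⟨hparW, hmjl⟩ := hparW_of_frame_ramM hρρ hvρ hΘΘ hΘρ hvΘ hF4 hΘP hP hd'v hρω hΘω hg1 hs01 hω h2M
    (by omega : 2 * d' = dρ + 2 * s0) hΘlam hu hu1' hmexp hjlexp (by omega)
  obtain ⟨hreal_on, hreal_off⟩ := realizable_of_frame_ramM hρρ hvρ hΘΘ hΘρ hvΘ hF4 hΘP hP hd'v hρω hΘω hω h2M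
    (by omega : 2 * d' = dρ + 2 * s0) hΘlam hu hu1' hmexp hjlexp (by omega) (by omega)
  -- the order filtration of `lam` (read at the datum uniformiser): `lam ∈ 𝒪_j ↔ j ≤ jl`, hence `jl ≤ J`
  have hIsOrd : ∀ (c z : w₁.1.adicCompletion E'), IsOrd ρ' α c z ↔ IsOrd ρ' ϖM c z := fun c z => isOrd_iff_isOrd_of_v_sub_map_eq hvαϖ c z
  have hρϖM : ρ' ϖM ≠ ϖM := fun h0 => by
    have h1 := hdρv; rw [h0, sub_self, map_zero] at h1; exact (pow_ne_zero _ (by rw [hϖM]; exact WithZero.coe_ne_zero)) h1.symm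
  have hiff : ∀ j, IsOrd ρ' ϖM (ιw ϖ ^ j) lam ↔ j ≤ jl := fun j =>
    isOrd_pow_iff_le hρϖM hϖE0 hϖE1 hvlam.le (by rw [hjl, map_mul, map_pow]) j
  have hJle : jl ≤ J := by have h := hJ; rw [hIsOrd, hiff] at h; omega
  -- READ the socket's census at THE uniformiser: `levelSet∕levelSetDep (α, h) = (ϖM, h)` (★ p858066, twist unit `1`)
  have hLS : ∀ (s : w₁.1.adicCompletion E') (j a : ℕ), levelSet ρ' Θ α (ιw ϖ) s j a = levelSet ρ' Θ ϖM (ιw ϖ) s j a :=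
    fun s j a => levelSet_eq_of_mul_sub_map_eq (Θ := Θ) hvαϖ (by rw [hαϖM]) _ j a
  have hLSD : ∀ (s μ' : w₁.1.adicCompletion E') (j a : ℕ), levelSetDep ρ' Θ α (ιw ϖ) s j a μ' = levelSetDep ρ' Θ ϖM (ιw ϖ) s j a μ' :=
    fun s μ' j a => levelSetDep_eq_of_twist (Θ := Θ) (e := 1) (map_one _) (map_one _) (mul_one s).symm (by rw [one_mul]; exact hαϖM) _ j a μ'
  -- the cut-offs, read from the NON-EMPTY cells (★ p858280 `_of_cells`): ★ p858283 (F0P3-p01 (g34)) `hRcells_h`∕`hRcells_h'` — type-free, from `hRV`∕`hRS`,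
  -- the literals `hth`∕`hta`, the frame equation, the line models and the norm clause `hFNM` — read at THE uniformiser through `hIsOrd`∕`hLSD`
  have hRcells : ∀ j b, 1 ≤ b → IsOrd ρ' ϖM (ιw ϖ ^ j) lam → (levelSetDep ρ' Θ ϖM (ιw ϖ) h j b (lam - ιw u₀)).Nonempty → b ≤ R := fun j b hb hjO hne =>
    hRcells_h L w hw hϖ hD h2v ιw hρρ hvρ hjle1 hjfix hΘj hΘΘ hΘρ hvΘ hρα hα1 hint hvlam hth φ hφc hφi hφs hφγ hφH hΘh hh hjpow hsmall hRV hu1 hFNM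
      j b hb ((hIsOrd _ _).2 hjO) (by rwa [hLSD])
  have hRcells' : ∀ j b, 1 ≤ b → IsOrd ρ' ϖM (ιw ϖ ^ j) lam → (levelSetDep ρ' Θ ϖM (ιw ϖ) h' j b (lam - ιw u₀)).Nonempty → b ≤ R' := fun j b hb hjO hne =>
    hRcells_h' L w hw hϖ hD h2v ιw hρρ hvρ hjle1 hjfix hΘj hΘΘ hΘρ hvΘ hρα hα1 hint hvlam hta hform hdg1 hdgσ hησ hη1 φ' hφ'c hφ'i hφ's hφ'γ hφ'H hΘh' hh'
      hjpow hsmall hRS hu1 hFNM j b hb ((hIsOrd _ _).2 hjO) (by rwa [hLSD])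
  simp only [hLS, hLSD, hIsOrd]
  -- (C-4) REINDEX both order counts (★ p858280 `_of_cells`, this seat)
  have hA := orderCounts_eq_censusSum_ramM_of_cells hDρ hΘΘ hΘρ hvΘ hρϖ hϖE hh hμ hjlμ qw hiff hJle hRcells
  have hA' := orderCounts_eq_censusSum_ramM_of_cells hDρ hΘΘ hΘρ hvΘ hρϖ hϖE hh' hμ hjlμ qw hiff hJle hRcells'
  -- (C-6) THE H-SIDE (★ p858207, LH4-p09 (g6)): `jl ≡ g (2)` and the Eisenstein closed form at level `(jl − g)∕2`
  obtain ⟨πF, hπF⟩ := v.valuation_exists_uniformizer ↥(maximalRealSubfield L)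
  have hϖF : Valued.v ((πF : ↥(maximalRealSubfield L)) : v.adicCompletion ↥(maximalRealSubfield L)) = WithZero.exp (-1 : ℤ) := by
    rw [IsDedekindDomain.HeightOneSpectrum.valuedAdicCompletion_eq_valuation', hπF]
  haveI : Finite (IsLocalRing.ResidueField 𝒪[v.adicCompletion ↥(maximalRealSubfield L)]) := finite_residueField_adicCompletion _ v
  have htube := v_disc_lt_tube (ϖ := ϖ) (v_pow_lt_v_two hϖ hD.2.2.2.2.2.2 (N := 2 * tE + 2) (by omega))
    (v_pow_sq_lt_tube hϖ hD.2.2.2.2.2.2 (N := 2 * tE + 2) le_rfl) hblock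
  obtain ⟨hjlg, hH⟩ := hSide_closedForm_ramM_hLevel L v w hw hϖF he hD γH.1 hirr htube E' c₁ hc₁1 w₁ hw₁ Θ hjle1 hjfix hΘj hΘΘ hΘρ hvΘ
    hρα hα1 hint hlam2 hρlam hΘlam hvlam hαC hDρ hDΘ hjl hg2
  -- the REGIME dichotomy of the tokens (S6b-RM + `jl ≡ g (2)`): the input `hreg` of LH4-p06's (S-far) wrapper
  have hreg : (m + s0 ≤ jl ∧ (m + s0) % 2 = jl % 2) ∨ jl + 1 = m + s0 :=
    (em (m % 2 = (g + s0) % 2)).elim (fun hpar => Or.inl ⟨hreal_on hpar, by omega⟩) fun hpar => Or.inr (hreal_off hpar)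
  -- (C-5b) THE SIGN `ε := (β, θ)_v` and the side letters (F0P3a-p01 (g34), pending)
  set ε : ℤ := hilbertSymbol (v.adicCompletion ↥(maximalRealSubfield L)) (β : (v.adicCompletion ↥(maximalRealSubfield L)))
      (algebraMap ↥(maximalRealSubfield L) _ ((cmQuadraticGenerator L : 𝓞 ↥(maximalRealSubfield L)) : ↥(maximalRealSubfield L))) with hεdef
  have hε : ε = 1 ∨ ε = -1 := hilbertSymbol_eq_one_or_eq_neg_one _ _
  -- the THIRD-FIELD package `K′ = K♮` (★ p857945), the anchor `n₀`, the scalar orders `vh vh′`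
  have hds : 2 * d' = dρ + 2 * s0 := by omega
  obtain ⟨eh, heh⟩ := F0P3cDyRamTokenRealizabilityRamM.exists_v_eq_exp hh
  obtain ⟨eh', heh'⟩ := F0P3cDyRamTokenRealizabilityRamM.exists_v_eq_exp hh'
  have hvh : Valued.v h = WithZero.exp (-(-eh)) := by rw [neg_neg]; exact heh
  have hvh' : Valued.v h' = WithZero.exp (-(-eh')) := by rw [neg_neg]; exact heh'
  -- the anisotropic line model: `h'` is anisotropic (★ p858030, LH4-p11)
  have hplane : ¬ ∃ x : Fin 2 → (w.1.adicCompletion L), x ≠ 0 ∧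
      pairing (galAdicCompletionMap (L := L) (IsCMField.complexConj L) hw) (Matrix.diagonal dg) x x = 0 :=
    not_exists_pairing_diagonal_self_eq_zero_of_formCongr (galAdicCompletionMap (L := L) (IsCMField.complexConj L) hw) P₁ dg η
      (by rw [← placeForm_antidiagOne]; exact hform) hdgσ
      (fun i h0 => by have h1 := hdg1 i; rw [h0, map_zero] at h1; exact zero_ne_one h1) hηN
  have haniso : ¬ ∃ z : (w₁.1.adicCompletion E'), z ≠ 0 ∧ h' * Θ z * z + ρ' (h' * Θ z * z) = 0 :=
    not_exists_herm_self_eq_zero_of_lineModel (galAdicCompletionMap (L := L) (IsCMField.complexConj L) hw) (Matrix.diagonal dg) ιw φ' hφ's hφ'H hplane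
  obtain ⟨ecl, he_cls⟩ : ∃ e : ℤ, -eh + dρ = 2 * e :=
    F0P3cDyRamClassLettersRamM.exists_half_order_add hDΘ.2.2.2.1 hΘh hh hvh hds
  obtain ⟨ecl', he_cls'⟩ : ∃ e : ℤ, -eh' + dρ = 2 * e :=
    F0P3cDyRamClassLettersRamM.exists_half_order_add hDΘ.2.2.2.1 hΘh' hh' hvh' hds
  have hq2dvd : 2 ∣ qw := two_dvd_natCard_residueField_of_v_two_lt_one h2v hqwdef.symm   -- ★ p858326 (LH4-p06): dyadic ⇒ `2 ∣ #𝓀_w`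
  -- the K′ package (★ p857945; for the τ-datum's even-valuation clause and the sign law) and the τ-datum at THE uniformiser (★ `isRamifiedQuadraticDatum_tau`, LH4-p06)
  obtain ⟨K', instF', instV', σ', π', jK, instDVR', instFin', -, instCS', hσ', hvσ', hfix', hπ', hdd', hjle, hjΘ, hjfixΘ, hjσ, hjπ, -⟩ :=
    exists_thirdFieldPackage_ramM hρρ hvρ hΘρ hDΘ hΘres hF4 hd'v
  have hDτ : IsRamifiedQuadraticDatum τ ϖM dτ (2 * tE) :=
    isRamifiedQuadraticDatum_tau hDρ hΘΘ hΘρ hvΘ hτ hfix' hπ' jK hjle hjfixΘ hjσ hjπ hdτv hdτ1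
  have hlamΘ : lam * Θ lam = 1 := by rw [mul_comm]; exact hΘlam
  -- (C-5b) Σ3b ★ p858419 (F0P3a-p01 (g34)): `(β, θ)_v = 1 ⟺ N(κ_S9) ∈ N_Θ`, with the normaliser `ν₀` and the anti-fixed `sθ` produced
  have hχ : ((finCharpolyTwo L v γH).eval (finGammaTwo L v γH)) w =
      u₀ ^ 2 - (((γH.1.val : GL (Fin 2) (UnitaryGroup.LocalRing L v)).val.map
        (Pi.evalRingHom (fun w' : UnitaryGroup.PlacesOver L v => w'.1.adicCompletion L) w))).trace * u₀ +
        (((γH.1.val : GL (Fin 2) (UnitaryGroup.LocalRing L v)).val.map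
          (Pi.evalRingHom (fun w' : UnitaryGroup.PlacesOver L v => w'.1.adicCompletion L) w))).det :=
    eval_finCharpolyTwo_finGammaTwo_apply_eq_quadratic L v w γH
  obtain ⟨ν₀, sθ, hν₀D, hσν₀, hsθ0, hσsθ, hρν, hνΘ, hdetν, hρsθ, hΘsθ, hjsθ0, hjν0, hlamν1, h1lam, h1u, hlamu, hS3b⟩ :=
    F0P3cDyRamSignSymbolRamM.hilbertSymbol_eq_one_iff_exists_rhoNorm_signKappa_ramM L w hw ϖ d tE hD h2v ιw hjE2 ρ' Θ hρρ hvρ hΘρ hΘΘ hvΘ hjfix hΘj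
      hΘlam hlam2 hρlam hirr' hDσ hu₀1 hmexp (by omega) (β : v.adicCompletion ↥(maximalRealSubfield L)) hχ hβ
  -- (C-5b) Σ3c ★ `sign_law_ramM` (F0P3a-p01 (g34)): THE RamM SIGN LAW (T)(E)(P)(M)(W) at `(K, ρ, u, ν, ω) := (E′_w₁, ρ', ιw u₀, ιw ν₀, ιw sθ)`
  obtain ⟨hT, hE, hP, hM, -⟩ := F0P3cDyRamSignLawRamM.sign_law_ramM hρρ hvρ hΘΘ hΘρ hvΘ hF4 hσ' hvσ' hfix' hπ' hdd' jK hjle hjΘ hjfixΘ hjσ hjπ hDΘ hFNM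
    hΘn₀ hn₀1 hn₀N hc₀ hdich hfS2 hϖM hg2 hds hg1 hlamΘ hu hu1' hρν hνΘ hdetν hρsθ hΘsθ hjsθ0
    (hlamν1.trans (by rw [WithZero.exp_le_exp]; omega)) h1lam h1u hlamu hmexp hjlexp hΘh hh hhyper hΘh' hh' haniso
    ((m : ℤ) - jl - ecl) ((m : ℤ) - jl - ecl')
  -- THE HEAD GLUE (g34 07:53:01Z; splice sheet LH4-p13 (g7) f08e6cbd): the four side letters from (T)(E)(P)(M) + Σ3b
  have hST : m + s0 ≤ jl → (∃ ω : w₁.1.adicCompletion E', Valued.v ω = 1 ∧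
      Valued.v (ρ' (lam - ιw u₀) / (lam - ιw u₀) * (ρ' (ω * Θ ω) / (ω * Θ ω)) - 1) ≤ WithZero.exp (-(2 * ((s0 : ℤ) + 2 * g - 1) + dρ))) → (ε : ℚ) = 1 := fun _ hx => by
    have h1 : ε = 1 := by rw [hεdef]; exact hS3b.2 (hT hx)
    rw [h1]; norm_num
  have hSE : m + s0 ≤ jl → (∃ ω : w₁.1.adicCompletion E', Valued.v ω = 1 ∧
      Valued.v (ρ' (lam - ιw u₀) / (lam - ιw u₀) * (ρ' n₀ / n₀) * (ρ' (ω * Θ ω) / (ω * Θ ω)) - 1) ≤ WithZero.exp (-(2 * ((s0 : ℤ) + 2 * g - 1) + dρ))) → (ε : ℚ) = -1 := fun _ hx => by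
    rcases hε with h1 | h1
    · exact absurd (hS3b.1 (by rw [hεdef] at h1; exact h1)) (hE hx)
    · rw [h1]; norm_num
  have hSP : jl + 1 = m + s0 → (∃ ω₁ : (w₁.1.adicCompletion E')ˣ, Valued.v (ω₁ : w₁.1.adicCompletion E') = 1 ∧
      Valued.v (1 + ρ' h / h * (ρ' (ϖM ^ ((m : ℤ) - jl - ecl) * Θ (ϖM ^ ((m : ℤ) - jl - ecl))) / (ϖM ^ ((m : ℤ) - jl - ecl) * Θ (ϖM ^ ((m : ℤ) - jl - ecl)))) /
        (ρ' (lam - ιw u₀) / (lam - ιw u₀)) * (ρ' ((ω₁ : w₁.1.adicCompletion E') * Θ ω₁) / ((ω₁ : w₁.1.adicCompletion E') * Θ ω₁))) ≤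
          WithZero.exp (-(2 * ((s0 : ℤ) + 2 * g - 1) + dρ))) → (ε : ℚ) = 1 := fun _ hx => by
    have h1 : ε = 1 := by rw [hεdef]; exact hS3b.2 (hP hx)
    rw [h1]; norm_num
  have hSM : jl + 1 = m + s0 → (∃ ω₁ : (w₁.1.adicCompletion E')ˣ, Valued.v (ω₁ : w₁.1.adicCompletion E') = 1 ∧
      Valued.v (1 + ρ' h' / h' * (ρ' (ϖM ^ ((m : ℤ) - jl - ecl') * Θ (ϖM ^ ((m : ℤ) - jl - ecl'))) / (ϖM ^ ((m : ℤ) - jl - ecl') * Θ (ϖM ^ ((m : ℤ) - jl - ecl')))) /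
        (ρ' (lam - ιw u₀) / (lam - ιw u₀)) * (ρ' ((ω₁ : w₁.1.adicCompletion E') * Θ ω₁) / ((ω₁ : w₁.1.adicCompletion E') * Θ ω₁))) ≤
          WithZero.exp (-(2 * ((s0 : ℤ) + 2 * g - 1) + dρ))) → (ε : ℚ) = -1 := fun _ hx => by
    rcases hε with h1 | h1
    · exact absurd (hS3b.1 (by rw [hεdef] at h1; exact h1)) (hM hx)
    · rw [h1]; norm_num
  -- (S-sign) FROM THE SIDE LETTER `hST` AT `ω := 1`: outside the window `jl + 2 ≤ m + 2g + s0` the regime is A and `κ_tw = ρμ∕μ ≡ 1` to depth `2jl + d_ρ − 2m ≥ 2(s0 + 2g − 1) + d_ρ`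
  have hεQ : (ε : ℚ) = 1 ∨ ((ε : ℚ) = -1 ∧ jl + 2 ≤ m + 2 * g + s0) := by
    rcases hε with h1 | h1
    · exact Or.inl (by rw [h1, Int.cast_one])
    by_cases hwin : jl + 2 ≤ m + 2 * g + s0
    · exact Or.inr ⟨by rw [h1, Int.cast_neg, Int.cast_one], hwin⟩
    refine Or.inl (hST (by omega) ⟨1, map_one _, ?_⟩)
    have hμ0 : lam - ιw u₀ ≠ 0 := fun h0 => by rw [h0, map_zero] at hmexp; exact WithZero.zero_ne_coe hmexp
    rw [map_one, mul_one, map_one, div_one, mul_one, div_sub_one hμ0, map_div₀, Valuation.map_sub_swap, hjlexp, hmexp, ← WithZero.exp_sub]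
    exact WithZero.exp_le_exp.2 (by omega)
  -- (C-3′) THE WELD OF THE FRAME (this seat, `toricCensusSum_ramM_weld_of_frame`): K′ package, class letters, tables, GEN∕OFF, near, far, weld — ONE call
  have hW := F0P3cDyRamToricCensusSumRamMWeldOfFrame.toricCensusSum_ramM_weld_of_frame hρρ hvρ hΘΘ hΘρ hvΘ hτ hΘres hϖM hDρ hDΘ hDτ hF4 hFNM hc₀ hdich
    hΘn₀ hn₀1 hn₀N hϖE hρϖ hqM hq2dvd hg2 hs02 hg1 hs01 hdKv hdK2 hd'v hd'2 hΘh hh hhyper hΘh' hh' haniso hvh hvh' he_cls he_cls' hlamΘ hu hu1' hμ hjlμ hjlg hmjl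
    (by omega) hparW hreg (ε : ℚ) hεQ hST hSE hSP hSM
  -- the closing arithmetic (★ p858013, LH4-p07): `n := (jl − g)∕2`, `S := d − d%2`
  have hq1 : 1 ≤ Fintype.card (Valued.ResidueField (w.1.adicCompletion L)) := Fintype.card_pos
  have hweld : ((ε : ℤ) : ℚ) * ((((∑ j ∈ Finset.range (jl + 1), ∑ a ∈ Finset.range (jl + 2),
        qw ^ a * (levelSetDep ρ' Θ ϖM (ιw ϖ) h j a (lam - ιw u₀)).ncard : ℕ) : ℚ)) -
      (((∑ j ∈ Finset.range (jl + 1), ∑ a ∈ Finset.range (jl + 2),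
        qw ^ a * (levelSetDep ρ' Θ ϖM (ιw ϖ) h' j a (lam - ιw u₀)).ncard : ℕ) : ℚ))) =
      (Fintype.card (Valued.ResidueField (w.1.adicCompletion L)) : ℚ) ^ m *
        (2 * ∑ i ∈ Finset.range ((jl - g) / 2 + 1), (Fintype.card (Valued.ResidueField (w.1.adicCompletion L)) : ℚ) ^ i -
          2 * ∑ i ∈ Finset.range (d - d % 2), (Fintype.card (Valued.ResidueField (w.1.adicCompletion L)) : ℚ) ^ i) := by
    rw [← hqw, ← hgs]
    push_cast
    rw [← hW, ← Finset.sum_sub_distrib]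
    congr 1
    refine Finset.sum_congr rfl fun j _ => ?_
    rw [← Finset.sum_sub_distrib]
    refine Finset.sum_congr rfl fun a _ => ?_
    ring
  rw [hA, hA', hqw]; rw [hqw] at hweld
  exact census_bottom_arith_eisenstein hε hweld hH hq1

end Summit.HodgeConjecture.HodgeConjecture.Cruxes.H413.F0P3cDyRamOrderCountCensusRamM

end
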